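import Literature.NumberTheory.GaloisCohomology.Howard2004.ModIdeal
import HarnessLib

/-!
# Howard 2004, Def. 1.2.3: the canonical presentations of the Kolyvagin quotients `T/I_nT`

Tranche 3e of (W9) (cell `pub/bsd-print-x9`): with `modIdeal` (tranche 3d) the level data of a
Kolyvagin system (tranche 2 `LevelData`: presentations of `T/I_nT` for the levels `n`, plus the
finite–singular slots) has a CANONICAL choice of presentations — `T ⧸ I_n•T` with the quotient map
— leaving only the slots `φ^{fs}` to be supplied.  «`κ_n ∈ H¹_{F(n)}(K, T/I_nT) ⊗ G_n`, one for each
`n ∈ 𝓝(𝓛)`» [arXiv:1202.6340 Def. 2.2.3, p. 7 L1–6].  Definitions with bodies and `rfl` lemmas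
only; no named fact, no `sorry`, no instance.
[cite: Howard2004HeegnerKolyvagin, Def. 1.2.3 (arXiv Def. 2.2.3, p. 7, L1–12)]
-/

set_option autoImplicit false

noncomputable section

open Function NumberField IsDedekindDomain Field
open scoped NumberField Classical TensorProduct

namespace Literature.NumberTheory.GaloisCohomology.Howard2004

open Literature.NumberTheory.GaloisRepresentations
open Literature.NumberTheory.GaloisRepresentations.DiscreteGaloisModule

namespace LevelData

variable {K : Type} [Field K] [NumberField K] {M : Type} [AddCommGroup M] [TopologicalSpace M]
  [DiscreteTopology M] {R : Type} [CommRing R] [Module R M] {p : ℕ}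

variable (R) in
/-- The carrier of the canonical presentation of `T/I_nT`: `T ⧸ I_n•T`.
[cite: Howard2004HeegnerKolyvagin, Def. 1.2.1 and Def. 1.2.3 (arXiv p. 6 L73–75, p. 7 L1–6)] -/
abbrev QuotCarrier (ρ : DiscreteGaloisModule K M) (n : Finset (HeightOneSpectrum (𝓞 K))) : Type :=
  M ⧸ (levelIdeal (R := R) ρ n • (⊤ : Submodule R M))

variable (R) in
/-- **The canonical level data**: `T/I_nT := T ⧸ I_n•T` with its quotient `Γ_K`-action (`modIdeal`)
and the quotient map as presentation (`isQuotientBy_modIdeal`), the finite–singular maps being the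
remaining slot. [cite: Howard2004HeegnerKolyvagin, Def. 1.2.3 (arXiv Def. 2.2.3, p. 7, L1–12)] -/
def canonical (ρ : DiscreteGaloisModule K M) (hρ : ρ.IsScalarLinear R) (t : SelmerTriple p ρ)
    (fs : ∀ (n : Finset (HeightOneSpectrum (𝓞 K))) (v : HeightOneSpectrum (𝓞 K)),
      galoisCohomology ((modIdeal ρ hρ (levelIdeal (R := R) ρ n)).toLocal (Sum.inr v)) 1 →+
        SingularQuotient (GaloisRep.toLocal v (modIdeal ρ hρ (levelIdeal (R := R) ρ n))) ⊗[ℤ]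
          Gell v) :
    LevelData R ρ t (QuotCarrier R ρ) where
  ρq n := modIdeal ρ hρ (levelIdeal (R := R) ρ n)
  π n := (levelIdeal (R := R) ρ n • (⊤ : Submodule R M)).mkQ
  isQuotientBy _ := isQuotientBy_modIdeal ρ hρ _
  fs := fs

/-- The presentation of the canonical level data is the quotient map. [cite: Howard2004HeegnerKolyvagin, Def. 1.2.3 (arXiv p. 7, L1–6)] -/
@[simp] theorem canonical_π (ρ : DiscreteGaloisModule K M) (hρ : ρ.IsScalarLinear R)
    (t : SelmerTriple p ρ) (fs : ∀ (n : Finset (HeightOneSpectrum (𝓞 K))) (v : HeightOneSpectrum (𝓞 K)),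
      galoisCohomology ((modIdeal ρ hρ (levelIdeal (R := R) ρ n)).toLocal (Sum.inr v)) 1 →+
        SingularQuotient (GaloisRep.toLocal v (modIdeal ρ hρ (levelIdeal (R := R) ρ n))) ⊗[ℤ]
          Gell v) (n : Finset (HeightOneSpectrum (𝓞 K))) (m : M) :
    (canonical R ρ hρ t fs).π n m = Submodule.Quotient.mk m := rfl

/-- The Galois action of the canonical level data on classes. [cite: Howard2004HeegnerKolyvagin, Def. 1.2.3 (arXiv p. 7, L1–6)] -/
@[simp] theorem canonical_ρq_apply_mk (ρ : DiscreteGaloisModule K M) (hρ : ρ.IsScalarLinear R)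
    (t : SelmerTriple p ρ) (fs : ∀ (n : Finset (HeightOneSpectrum (𝓞 K))) (v : HeightOneSpectrum (𝓞 K)),
      galoisCohomology ((modIdeal ρ hρ (levelIdeal (R := R) ρ n)).toLocal (Sum.inr v)) 1 →+
        SingularQuotient (GaloisRep.toLocal v (modIdeal ρ hρ (levelIdeal (R := R) ρ n))) ⊗[ℤ]
          Gell v) (n : Finset (HeightOneSpectrum (𝓞 K))) (σ : absoluteGaloisGroup K) (m : M) :
    (canonical R ρ hρ t fs).ρq n σ (Submodule.Quotient.mk m) = Submodule.Quotient.mk (ρ σ m) := rfl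

end LevelData

end Literature.NumberTheory.GaloisCohomology.Howard2004
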